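import Mathlib
import Summits.NavierStokesRegularity.NavierStokesRegularity.Theses.VortexLineClock
import HarnessLib

/-!
# Route VortexLineClock — the pure-logic items `WindowGlue` and `Assembly` PROVED
  (stmt-NavierStokesRegularity-11280 / 11281)

* `vortexLineClock_windowGlue_proof`: `FluxCapacityRecurrence → SeifertResidual → ProfileClockNoCycle
  → EmptyEulerWindow` — unpack the window clauses (`γ ≠ −1` from `2/5 ≤ γ`, `C¹` from `C²`): the
  a.e.-recurrent vortex-line flow (`FluxCapacityRecurrence`) has a closed vortex line
  (`SeifertResidual`), which the exact-profile clock theorem (`ProfileClockNoCycle`) forbids.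
* `vortexLineClock_assembly_proof`: `TypeIIWindowCore → EmptyEulerWindow → NoTypeIBlowup →
  NoBlowupToClay → NavierStokesRegularity` (the route's deciding theorem `closes`, curried).

HONEST FRAMING: pure logic; the route's cruxes and the three Euler-side supports remain OPEN items;
nothing here bears on the regularity question. Lands `--workitem stmt-NavierStokesRegularity-11280`
(typer seat g19 of cell pub-ns-dss, idle-row item).
-/

namespace Summit.NavierStokesRegularity.NavierStokesRegularity.Theorems

set_option linter.dupNamespace false

/-- **`WindowGlue` (stmt-NavierStokesRegularity-11280)**: the three Euler-side supports empty the
Euler window (pure logic). [this file] -/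
theorem vortexLineClock_windowGlue_proof : Theses.VortexLineClock.WindowGlue := by
  intro hF hS hP γ U Ω hW
  obtain ⟨hγ1, -, hU2, hΩ1, -, -, hLip, ⟨c, P, -, -, hΩeq⟩, -, -⟩ := id hW
  obtain ⟨x, τ, hτ, hx, hper, hne⟩ := hS γ U Ω hW (hF γ U Ω hW)
  exact hP γ c U Ω (by linarith) (hU2.of_le (by norm_cast)) hΩ1 hLip hΩeq ⟨x, τ, hτ, hx, hper, hne⟩

/-- **`Assembly` of route VortexLineClock (stmt-NavierStokesRegularity-11281)**: the curried deciding
theorem (pure logic: a maximal solution is either Type I — excluded by `NoTypeIBlowup` — or yields a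
window profile by `TypeIIWindowCore`, excluded by `EmptyEulerWindow`; `NoBlowupToClay` concludes).
[this file] -/
theorem vortexLineClock_assembly_proof : Theses.VortexLineClock.Assembly := by
  intro h₁ h₂ h₃ h₄
  apply h₄
  intro ν T hν hT u p hcl hLH hdec
  by_contra hext
  have hmax : Literature.Analysis.FluidPDE.IsMaximalSmoothSolution ν 0 u p T := ⟨hcl, hext⟩
  by_cases hI : Literature.Analysis.FluidPDE.IsTypeIBlowup u T
  · exact hext (h₃ ν T hν hT u p hcl hLH hdec hI)
  · obtain ⟨γ, U, Ω, hW, -⟩ := h₁ ν T hν hT u p hmax hLH hdec hI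
    exact h₂ γ U Ω hW

end Summit.NavierStokesRegularity.NavierStokesRegularity.Theorems
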